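import Literature.NumberTheory.LFunctions.MoebiusAutomaticExpSumBridge
import Literature.NumberTheory.LFunctions.MoebiusAutomaticCarry
import Literature.NumberTheory.LFunctions.AutomaticSequenceBaseChange
import HarnessLib

/-!
# Müllner's reduction with a synchronizing prefix: Thm. 1.2 from root estimates without shift (proved)

Everything in this file is PROVED (plus one plain definition, a property with parameters that is
NOT asserted). It refines the tree's formalisation of Prop. 3.3 of C. Müllner, *Automatic
sequences fulfill the Sarnak conjecture* (Duke Math. J. 166 (2017)), §3.1
(`MoebiusAutomaticTransducerReduction.lean`), for the named fact
`Literature.NumberTheory.LFunctions.mullner_moebius_automatic`, in the two respects in which the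
paper's own bookkeeping is lighter than the tree's first version:

1. **Synchronizing prefixes** (Müllner's density-one set `M`, Lemma "setDens", §3.1:
   `(n)_k = v₁ v₂` with `δ'(q', v₁)` in a final component for all `q'` AND every synchronizing
   word `w_i` a subword of `v₂`). Fixing the first `λ₁ = λ₁' + λ₁''` digits `b` of `n`, we ask
   that the first `λ₁'` lead into the final states (`enterBad`) and that the next `λ₁''` contain
   the concatenation `W` of synchronizing words of all components (`syncBad`). Then the transducer
   state after the prefix is DETERMINED, and reading the whole padded word `(n)_k^ν` from a fixed
   root `M∗` of the component's transducer gives `T(M∗, (n)_k^ν) = T(M_b, x) · T(M∗, (b)_k^{λ₁})`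
   — no shift of the argument is needed (the tree's first version and
   `MoebiusAutomaticExpSumBridge.lean` re-root at the price of a shift `n ↦ n + r`).
2. **Zero-stable roots** (`δ(M∗, 0) = M∗`, `T(M∗, 0) = id`, `MoebiusAutomaticCarry.lean`): then
   `T(M∗, (n)_k^ν) = T(M∗, (n)_k)` (`MinImage.T_msbBlock_eq`), so the hypothesis is about the
   plain digital sequence `n ↦ T(M∗, (n)_k)`, the object of Müllner's §4 (`T(n) := T(q₀,(n)_k)`),
   whose carry property is `MinImage.hasCarryProperty_T`.

Results:
* `RootAPEstimate k δ' M` — the property (NOT asserted): for all `π`, `q ≥ 1`, `c`, `ε > 0`,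
  eventually `|∑_{n<x, n≡c (q), T(M,(n)_k)=π} μ(n)| ≤ εx`; it is `TransducerAPEstimate` at shift
  `r = 0` (`TransducerAPEstimate.root`).
* `isLittleO_moebiusSum_dfaoSeq_of_rootAPEstimate` — for a finite DFAO `(σ, δ, q₀, τ)` read from
  the most significant digit with `δ(q₀,0) = q₀` and letters `≥ k` acting trivially: if every final
  component has a zero-stable root of its transducer with `RootAPEstimate`, then
  `∑_{n≤N} a_n μ(n) = o(N)`.
* `mullner_moebius_automatic_of_rootAPEstimate_pow` — **the assembly through the base change
  `k ↦ k^p`** (Prop. 2.25, `dfaoSeq_pow`, `IsAutomaticSeq` ⇒ DFAO ⇒ `optionLift` normalisation):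
  `mullner_moebius_automatic` follows if for every `k ≥ 2` and every finite base-`k` DFAO with
  `δ(q₀, 0) = q₀` SOME power `p ≥ 1` makes the digit-restricted power automaton satisfy the
  hypothesis of the previous theorem. This is the form in which the analytic part (Thm. 4.4 with
  Lemma 4.10 and Thm. 4.5, in base `k^p` where zero-stable roots exist,
  `MinImage.exists_zeroStable_pow`) closes the fact.
* `rootAPEstimate_of_minRank_eq_one` — non-vacuity (rank one: `μ` in progressions).

## References
* C. Müllner, Duke Math. J. 166 (2017) = arXiv:1602.03042, §3.1 (Lemma setDens, Prop. 3.2,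
  Prop. 3.3), Prop. 2.25 / Cor. 2.26. [Mullner2017]
-/

noncomputable section

open Finset Filter Asymptotics
open scoped ArithmeticFunction.Moebius

namespace Literature.NumberTheory.LFunctions

section Root

variable {σ' : Type*} [Fintype σ'] [DecidableEq σ']

/-- **Prop. 3.2 at a root, without shift** (a property, NOT asserted): for every output `π`,
modulus `q ≥ 1`, residue `c` and `ε > 0`, for all large `x`,
`|∑_{n < x, n ≡ c (q), T(M, (n)_k) = π} μ(n)| ≤ ε x`. For the representations `D_ℓ` this is `μ`
in progressions (Lemma 4.11); otherwise it is Thm. 4.4 for `f(n) = D(T(M,(n)_k))` and additive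
characters mod `q`. [cite: Mullner2017, Prop. 3.2 / §4.3] -/
def RootAPEstimate (k : ℕ) (δ' : σ' → ℕ → σ') (M : MinImage δ') : Prop :=
  ∀ (π : Equiv.Perm (Fin (minRank δ'))) (q : ℕ), 0 < q → ∀ (c : ℕ) (ε : ℝ), 0 < ε →
    ∃ x₀ : ℕ, ∀ x : ℕ, x₀ ≤ x →
      ‖∑ n ∈ (range x).filter (fun n => n % q = c ∧ M.T ((Nat.digits k n).reverse) = π),
        (μ n : ℂ)‖ ≤ ε * x

/-- The shift-uniform property specialises to the root property (`r = 0`). [folklore] -/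
theorem TransducerAPEstimate.root {k : ℕ} {δ' : σ' → ℕ → σ'} {M : MinImage δ'}
    (h : TransducerAPEstimate k δ' M) : RootAPEstimate k δ' M := by
  intro π q hq c ε hε
  obtain ⟨x₀, hx₀⟩ := h π q hq c ε hε
  exact ⟨x₀, fun x hx => by simpa using hx₀ x hx 0⟩

/-- Non-vacuity: transducers of rank one. [cite: Mullner2017, Prop. 3.2 (case n₀(A) = 1)] -/
theorem rootAPEstimate_of_minRank_eq_one {k : ℕ} {δ' : σ' → ℕ → σ'} (h1 : minRank δ' = 1)
    (M : MinImage δ') : RootAPEstimate k δ' M :=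
  (transducerAPEstimate_of_minRank_eq_one h1 M).root

/-- **Uniform smallness of initial segments** from `RootAPEstimate`: given finitely many outputs
and residues (all of them: the group is finite, residues `< q`), for `ε > 0` there is `N₀` with
`|∑_{n<y, n≡c (q), T(M,(n)_k)=π} μ(n)| ≤ ε N` for ALL `y ≤ N + 1`, `N ≥ N₀`, all `π`, all `c`.
[folklore] -/
theorem RootAPEstimate.uniform_segments {k : ℕ} {δ' : σ' → ℕ → σ'} {M : MinImage δ'}
    (h : RootAPEstimate k δ' M) {q : ℕ} (hq : 0 < q) {ε : ℝ} (hε : 0 < ε) :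
    ∃ N₀ : ℕ, ∀ N : ℕ, N₀ ≤ N → ∀ (π : Equiv.Perm (Fin (minRank δ'))) (c y : ℕ), y ≤ N + 1 →
      ‖∑ n ∈ (range y).filter (fun n => n % q = c ∧ M.T ((Nat.digits k n).reverse) = π),
        (μ n : ℂ)‖ ≤ ε * N := by
  classical
  have hε2 : 0 < ε / 2 := by positivity
  choose x₀ hx₀ using fun (π : Equiv.Perm (Fin (minRank δ'))) (c : ℕ) => h π q hq c (ε / 2) hε2
  set X₀ : ℕ := univ.sup fun π => (range q).sup (x₀ π) with hX₀
  obtain ⟨N₁, hN₁⟩ := exists_nat_gt ((X₀ : ℝ) / (ε / 2))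
  refine ⟨N₁, fun N hN π c y hy => ?_⟩
  have hX₀N : (X₀ : ℝ) ≤ ε / 2 * N := by
    have : (X₀ : ℝ) / (ε / 2) ≤ N := hN₁.le.trans (by exact_mod_cast hN)
    rwa [div_le_iff₀ hε2, mul_comm] at this
  have hN0 : (0 : ℝ) ≤ N := Nat.cast_nonneg N
  rcases le_or_gt q c with hc | hc
  · have : ((range y).filter fun n => n % q = c ∧ M.T ((Nat.digits k n).reverse) = π) = ∅ :=
      filter_eq_empty_iff.2 fun n _ hn => absurd hn.1 ((Nat.mod_lt n hq).trans_le hc).ne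
    rw [this, sum_empty, norm_zero]; positivity
  rcases le_or_gt (x₀ π c) y with hxy | hxy
  · rcases Nat.eq_zero_or_pos N with hN0' | hNpos
    · -- `N = 0`: then `y ≤ 1` and the sum is over `n < 1`, i.e. `μ 0 = 0`
      have hy1 : y ≤ 1 := by omega
      have hzero : (∑ n ∈ (range y).filter (fun n => n % q = c ∧
          M.T ((Nat.digits k n).reverse) = π), (μ n : ℂ)) = 0 := by
        refine sum_eq_zero fun n hn => ?_
        have hn0 : n = 0 := by
          have := mem_range.1 (mem_filter.1 hn).1; omega
        simp [hn0]
      rw [hzero, norm_zero]; positivity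
    · have h1 : (1 : ℝ) ≤ N := by exact_mod_cast hNpos
      calc _ ≤ ε / 2 * y := hx₀ π c y hxy
        _ ≤ ε / 2 * (N + 1) := by gcongr; exact_mod_cast hy
        _ ≤ ε * N := by nlinarith
  · have hyX : y ≤ X₀ :=
      hxy.le.trans ((le_sup (f := x₀ π) (mem_range.2 hc)).trans
        (le_sup (f := fun π => (range q).sup (x₀ π)) (mem_univ π)))
    calc _ ≤ (y : ℝ) := norm_sum_filter_moebius_le y _
      _ ≤ X₀ := by exact_mod_cast hyX
      _ ≤ ε / 2 * N := hX₀N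
      _ ≤ ε * N := by nlinarith

end Root

/-! ## The reduction with a synchronizing prefix -/

section Main

/-- Counting integers `n ≤ N` by a property of their quotient: `#{n ≤ N : P(⌊n/D⌋)}` is at most
`D · #{b < K : P b}` when all quotients are `< K`. [folklore] -/
theorem card_filter_div_le {D K N : ℕ} (hD : 0 < D) (hN : N < K * D) (P : ℕ → Prop)
    [DecidablePred P] :
    ((range (N + 1)).filter fun n => P (n / D)).card ≤ ((range K).filter P).card * D := by
  calc ((range (N + 1)).filter fun n => P (n / D)).card
      ≤ ((range (N + 1)).filter fun n => n / D ∈ (range K).filter P).card := by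
        refine card_le_card fun n hn => ?_
        rw [mem_filter] at hn ⊢
        refine ⟨hn.1, mem_filter.2 ⟨mem_range.2 ?_, hn.2⟩⟩
        rw [Nat.div_lt_iff_lt_mul hD]
        exact lt_of_le_of_lt (Nat.le_of_lt_succ (mem_range.1 hn.1)) hN
    _ ≤ ((range K).filter P).card * D := card_filter_div_mem_le D hD _ N

/-- The arithmetic of the constants in the structured part. [folklore] -/
theorem rootReduction_const_identity (ε B K1 K2 P N : ℝ) (hB : 0 < B) (hK1 : 0 < K1)
    (hK2 : 0 < K2) (hP : 0 < P) :
    K1 * (K2 * (P * (B * (2 * (ε / (16 * B * K1 * K2 * P) * N))))) = ε / 8 * N := by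
  field_simp
  ring

set_option maxHeartbeats 400000 in
/-- **Müllner 2017, Prop. 3.3 with synchronizing prefixes and zero-stable roots.** Let `k ≥ 2`
and let `(σ, δ, q₀, τ)` be a finite DFAO read from the most significant digit with
`δ(q₀, 0) = q₀` and the letters `≥ k` acting trivially. Suppose that for every final state `p`
the transducer of the component of `p` has a zero-stable state `M∗` (`δ(M∗,0) = M∗`,
`T(M∗,0) = id`) with `RootAPEstimate k _ M∗`. Then `∑_{n ≤ N} τ(δ(q₀,(n)_k)) μ(n) = o(N)`.
See the module docstring for the proof (Müllner §3.1 with the set `M` of Lemma setDens).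
[cite: Mullner2017, Prop. 3.3] -/
theorem isLittleO_moebiusSum_dfaoSeq_of_rootAPEstimate {σ : Type} [Fintype σ] [DecidableEq σ]
    {k : ℕ} (hk : 2 ≤ k) (δ : σ → ℕ → σ) (q₀ : σ) (τ : σ → ℂ) (h0 : δ q₀ 0 = q₀)
    (hδtriv : ∀ q d, k ≤ d → δ q d = q)
    (H : ∀ p ∈ finalStates δ, ∃ Mr : MinImage (restrictδ δ (reach δ p) (reach_closed δ p)),
      Mr.next [0] = Mr ∧ Mr.T [0] = 1 ∧
        RootAPEstimate k (restrictδ δ (reach δ p) (reach_closed δ p)) Mr) :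
    moebiusSum (dfaoSeq k δ q₀ τ) =o[atTop] fun N : ℕ => (N : ℝ) := by
  classical
  have hk1 : 1 < k := hk
  have hk0 : 0 < k := by omega
  -- the final states
  set F : Set σ := ↑(finalStates δ) with hF_def
  have hF : ∀ q ∈ F, ∀ d, d < k → δ q d ∈ F := fun q hq d _ => by
    rw [hF_def, mem_coe] at hq ⊢
    exact finalStates_closed hq d
  have hreach : ∀ q : σ, ∃ u : List ℕ, (∀ d ∈ u, d < k) ∧ u.foldl δ q ∈ F := by
    intro q
    obtain ⟨u, hu⟩ := exists_wordAct_mem_finalStates δ q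
    refine ⟨u.filter (· < k), fun d hd => mem_filter_lt hd, ?_⟩
    rw [hF_def, mem_coe, ← wordAct_def, ← wordAct_filter_of_trivial hδtriv]
    exact hu
  -- the components, their transducers, their roots
  let δC : (p : σ) → ↥(reach δ p) → ℕ → ↥(reach δ p) :=
    fun p => restrictδ δ (reach δ p) (reach_closed δ p)
  have hroot : ∀ p : σ, ∃ Mr : MinImage (δC p), p ∈ finalStates δ →
      Mr.next [0] = Mr ∧ Mr.T [0] = 1 ∧ RootAPEstimate k (δC p) Mr := by
    intro p
    by_cases hp : p ∈ finalStates δ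
    · obtain ⟨Mr, hMr⟩ := H p hp
      exact ⟨Mr, fun _ => hMr⟩
    · exact ⟨transducerBase (δC p), fun h => absurd h hp⟩
  choose Mr hMr using hroot
  have hCtriv : ∀ p (q : ↥(reach δ p)) d, k ≤ d → δC p q d = q :=
    fun p q d hd => Subtype.ext (hδtriv _ _ hd)
  have hw₀ : ∀ p : σ, ∃ w : List ℕ, (∀ d ∈ w, d < k) ∧
      (fullImage (δC p) w).card = minRank (δC p) := by
    intro p
    obtain ⟨w, hw⟩ := exists_card_fullImage_eq_minRank (δC p)
    refine ⟨w.filter (· < k), fun d hd => mem_filter_lt hd, ?_⟩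
    rw [← hw, fullImage, fullImage]
    congr 1
    exact image_congr fun q _ => (wordAct_filter_of_trivial (hCtriv p) w q).symm
  choose w₀ hw₀d hw₀c using hw₀
  -- the concatenated synchronizing word
  set W : List ℕ := ((finalStates δ).toList.map w₀).flatten with hW_def
  have hW : ∀ d ∈ W, d < k := by
    intro d hd
    rw [hW_def, List.mem_flatten] at hd
    obtain ⟨l, hl, hdl⟩ := hd
    obtain ⟨p, -, rfl⟩ := List.mem_map.1 hl
    exact hw₀d p d hdl
  have hW₀ : ∀ p ∈ finalStates δ, w₀ p <:+: W := fun p hp =>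
    List.infix_of_mem_flatten (List.mem_map.2 ⟨p, mem_toList.2 hp, rfl⟩)
  -- bounds for the values and the group sizes
  set B : ℝ := 1 + ∑ q, ‖τ q‖
  have hB0 : 0 < B := by
    have : 0 ≤ ∑ q, ‖τ q‖ := sum_nonneg fun _ _ => norm_nonneg _
    linarith
  have hτ : ∀ q, ‖τ q‖ ≤ B := fun q =>
    (single_le_sum (f := fun q => ‖τ q‖) (fun _ _ => norm_nonneg _) (mem_univ q)).trans
      (by linarith)
  set a := dfaoSeq k δ q₀ τ with ha_def
  have ha : ∀ n, ‖a n‖ ≤ B := fun n => hτ _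
  set P : ℕ := (Fintype.card σ).factorial with hP
  have hP1 : 1 ≤ P := Nat.one_le_iff_ne_zero.2 (Nat.factorial_ne_zero _)
  have hPerm : ∀ p : σ, Fintype.card (Equiv.Perm (Fin (minRank (δC p)))) ≤ P := by
    intro p
    rw [Fintype.card_perm, Fintype.card_fin, hP]
    exact Nat.factorial_le ((minRank_le_card (δC p)).trans
      (by rw [Fintype.card_coe]; exact card_le_univ _))
  rw [isLittleO_iff]
  intro ε hε
  have hkR : (0 : ℝ) < k := by exact_mod_cast hk0
  -- the levels `λ₁ = λ₁' + λ₁''` and `λ₂`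
  obtain ⟨mlen, hm⟩ := exists_uniform_enter hk1.le hF hreach
  obtain ⟨l1', hl1'⟩ := exists_card_le_of_card_mul_le hk1 (S := fun L => enterBad k δ q₀ F L)
    (card_enterBad_mul_le hk1 hF hm) (η := ε / (16 * B * k)) (by positivity)
  obtain ⟨l1s, hl1s⟩ := exists_card_syncBad_le hk1 hW (η := ε / (16 * B * k)) (by positivity)
  obtain ⟨l2, hl2⟩ := exists_card_syncBad_le hk1 hW (η := ε / (16 * B)) (by positivity)
  set l1 := l1' + l1s with hl1
  set K1' := k ^ l1' with hK1'
  set K1s := k ^ l1s with hK1s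
  set K1 := k ^ l1 with hK1
  set K2 := k ^ l2 with hK2
  have hK1'pos : 0 < K1' := pow_pos hk0 _
  have hK1spos : 0 < K1s := pow_pos hk0 _
  have hK1pos : 0 < K1 := pow_pos hk0 _
  have hK2pos : 0 < K2 := pow_pos hk0 _
  have hK1eq : K1 = K1' * K1s := by rw [hK1, hl1, pow_add]
  have hK1R : (0 : ℝ) < K1 := by exact_mod_cast hK1pos
  have hK2R : (0 : ℝ) < K2 := by exact_mod_cast hK2pos
  -- states after the two parts of the prefix
  set p₁ : ℕ → σ := fun b => (msbBlock k l1' (b / K1s)).foldl δ q₀ with hp₁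
  set pb : ℕ → σ := fun b => (msbBlock k l1 b).foldl δ q₀ with hpb
  -- the thresholds from the root estimates
  set ε₃ : ℝ := ε / (16 * B * K1 * K2 * P) with hε₃
  have hε₃pos : 0 < ε₃ := by positivity
  have HN : ∀ p : σ, ∃ Np : ℕ, p ∈ finalStates δ → ∀ N : ℕ, Np ≤ N →
      ∀ (π : Equiv.Perm (Fin (minRank (δC p)))) (c y : ℕ), y ≤ N + 1 →
      ‖∑ n ∈ (range y).filter (fun n => n % K2 = c ∧
          (Mr p).T ((Nat.digits k n).reverse) = π), (μ n : ℂ)‖ ≤ ε₃ * N := by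
    intro p
    by_cases hp : p ∈ finalStates δ
    · obtain ⟨Np, hNp⟩ := (hMr p hp).2.2.uniform_segments hK2pos hε₃pos
      exact ⟨Np, fun _ => hNp⟩
    · exact ⟨0, fun h => absurd h hp⟩
  choose Np hNp using HN
  refine eventually_atTop.2 ⟨max (univ.sup Np) (k ^ (l1 + l2)), fun N hN => ?_⟩
  have hN3 : ∀ p, Np p ≤ N := fun p => ((le_sup (f := Np) (mem_univ p)).trans (le_max_left _ _)).trans hN
  have hNpow : k ^ (l1 + l2) ≤ N := (le_max_right _ _).trans hN
  have hNpos : 0 < N := lt_of_lt_of_le (pow_pos hk0 _) hNpow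
  have hK2N : K2 ≤ N := (Nat.pow_le_pow_right hk0 (Nat.le_add_left l2 l1)).trans hNpow
  rw [Real.norm_natCast]
  -- `ν` digits
  set ν := (Nat.digits k N).length with hν
  have hNν : N < k ^ ν := Nat.lt_base_pow_length_digits hk1
  have hνN : k ^ ν ≤ k * N := Nat.base_pow_length_digits_le k N hk1 hNpos.ne'
  have hl12 : l1 + l2 ≤ ν :=
    ((Nat.pow_lt_pow_iff_right hk1).1 (lt_of_le_of_lt hNpow hNν)).le
  set D := k ^ (ν - l1) with hD
  have hDpos : 0 < D := pow_pos hk0 _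
  have hK1D : K1 * D = k ^ ν := by rw [hK1, hD, ← pow_add]; congr 1; omega
  have hK1DR : (K1 : ℝ) * D ≤ k * N := by exact_mod_cast hK1D.le.trans hνN
  have hNK1D : N < K1 * D := by rw [hK1D]; exact hNν
  -- the remaining digits after the prefix, as a word
  set xw : ℕ → List ℕ := fun n => msbBlock k (ν - l1) (n % D) with hxw
  -- goodness of a prefix
  set GoodTop : ℕ → Prop := fun b => b / K1s ∉ enterBad k δ q₀ F l1' with hGoodTop
  set GoodMid : ℕ → Prop := fun b => b % K1s ∉ syncBad k l1s W with hGoodMid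
  have hfin_of_good : ∀ b, b < K1 → GoodTop b → p₁ b ∈ finalStates δ := by
    intro b hb hgood
    by_contra hc'
    refine hgood (mem_enterBad.2 ⟨?_, by rwa [hF_def, mem_coe]⟩)
    rw [Nat.div_lt_iff_lt_mul hK1spos, ← hK1eq]; exact hb
  -- the prefix word splits
  have hprefix : ∀ b, b < K1 →
      msbBlock k l1 b = msbBlock k l1' (b / K1s) ++ msbBlock k l1s (b % K1s) := by
    intro b hb
    have hdiv : b / K1s < k ^ l1' := by
      rw [Nat.div_lt_iff_lt_mul hK1spos, ← hK1', ← hK1eq]; exact hb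
    conv_lhs => rw [hl1, ← Nat.div_add_mod b K1s]
    rw [hK1s]
    exact msbBlock_add hk1 hdiv (Nat.mod_lt _ hK1spos)
  have hpb_eq : ∀ b, b < K1 → pb b = (msbBlock k l1s (b % K1s)).foldl δ (p₁ b) := by
    intro b hb
    simp only [hpb, hp₁]
    rw [hprefix b hb, List.foldl_append]
  have hpb_mem : ∀ b, b < K1 → pb b ∈ reach δ (p₁ b) := fun b hb => by
    rw [hpb_eq b hb]; exact mem_reach.2 ⟨_, rfl⟩
  -- the transducer state after the prefix, read from the root
  set Mb : (b : ℕ) → MinImage (δC (p₁ b)) := fun b => (Mr (p₁ b)).next (msbBlock k l1 b) with hMb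
  set Good : ℕ → Prop := fun b => b < K1 ∧ GoodTop b ∧ GoodMid b with hGood_def
  have hW_of_goodMid : ∀ b, GoodMid b → W <:+: msbBlock k l1s (b % K1s) := by
    intro b hgood
    by_contra hc
    exact hgood (mem_syncBad.2 ⟨Nat.mod_lt _ hK1spos, hc⟩)
  have hMb_mem : ∀ b (h : Good b), (⟨pb b, hpb_mem b h.1⟩ : ↥(reach δ (p₁ b))) ∈ (Mb b).1 := by
    intro b h
    obtain ⟨hb, htop, hmid⟩ := h
    have hfin := hfin_of_good b hb htop
    obtain ⟨M₁, hM₁, hpM₁⟩ := exists_mem_minImages_mem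
      (isStronglyConnected_restrict_reach (δ := δ) hfin) ⟨p₁ b, self_mem_reach δ (p₁ b)⟩
    -- `⟨pb b, _⟩ = wordAct (δC (p₁ b)) (block b₂) ⟨p₁ b, _⟩ ∈ M₁.next (block b₂) = Mb b`
    have hsync : MinImage.next (⟨M₁, hM₁⟩ : MinImage (δC (p₁ b))) (msbBlock k l1s (b % K1s)) =
        Mb b := by
      rw [hMb]
      simp only
      rw [hprefix b hb, MinImage.next_append]
      exact MinImage.next_eq_next_of_infix _ _ (hw₀c (p₁ b))
        (((hW₀ _ hfin).trans (hW_of_goodMid b hmid)))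
    rw [← hsync, MinImage.coe_next]
    refine mem_image.2 ⟨⟨p₁ b, self_mem_reach δ (p₁ b)⟩, hpM₁, Subtype.ext ?_⟩
    rw [coe_wordAct_restrictδ, wordAct_def, ← hpb_eq b hb]
  -- the functions `Ψ_{b,m}` on the groups, and the group elements
  set cst : (b : ℕ) → Equiv.Perm (Fin (minRank (δC (p₁ b)))) := fun b =>
    (Mr (p₁ b)).T (msbBlock k l1 b) with hcst
  set Ψ : (b : ℕ) → ℕ → Equiv.Perm (Fin (minRank (δC (p₁ b)))) → ℂ := fun b m π =>
    if h : Good b then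
      τ (((((Mb b).next (w₀ (p₁ b) ++ msbBlock k l2 m)).enum.symm
        (π ((Mb b).enum ⟨⟨pb b, hpb_mem b h.1⟩, hMb_mem b h⟩))) : ↥(reach δ (p₁ b))) : σ)
    else 0 with hΨ
  have hΨB : ∀ b m π, ‖Ψ b m π‖ ≤ B := by
    intro b m π
    simp only [hΨ]
    split_ifs
    · exact hτ _
    · rw [norm_zero]; exact hB0.le
  set TT : (b : ℕ) → ℕ → Equiv.Perm (Fin (minRank (δC (p₁ b)))) := fun b n =>
    (Mr (p₁ b)).T ((Nat.digits k n).reverse) * (cst b)⁻¹ with hTT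
  -- (0) the key identity (Müllner §3.1: reconstruction after synchronisation, from the root)
  have key : ∀ n, n < k ^ ν → ∀ (h : Good (n / D)), n % K2 ∉ syncBad k l2 W →
      a n = Ψ (n / D) (n % K2) (TT (n / D) n) := by
    intro n hnν h hgood2
    set b := n / D with hb_def
    obtain ⟨hbK, htop, hmid⟩ := h
    have hfin := hfin_of_good b hbK htop
    have hzs := hMr (p₁ b) hfin
    have hR : n % D < D := Nat.mod_lt _ hDpos
    -- split the padded word `(n)_k^ν = (b)_k^{l1} ++ xw n`
    have hsplit1 : msbBlock k ν n = msbBlock k l1 b ++ xw n := by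
      have h1 : n = D * b + n % D := by rw [hb_def]; exact (Nat.div_add_mod n D).symm
      conv_lhs => rw [show ν = l1 + (ν - l1) by omega, h1]
      exact msbBlock_add hk1 hbK hR
    -- the suffix contains `w₀ (p₁ b)`
    have hwinf : w₀ (p₁ b) <:+: msbBlock k l2 (n % K2) := by
      have hWinf : W <:+: msbBlock k l2 (n % K2) := by
        by_contra hc
        exact hgood2 (mem_syncBad.2 ⟨Nat.mod_lt _ hK2pos, hc⟩)
      exact (hW₀ _ hfin).trans hWinf
    -- (a) reading: `a n = τ (wordAct δ (xw n) (pb b))`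
    have hread : a n = τ (wordAct δ (xw n) (pb b)) := by
      rw [ha_def, dfaoSeq_eq_of_fix_zero h0 k ν, ← wordAct_def, hsplit1, wordAct_append]
      rfl
    -- (b) inside the component, through the transducer (Prop. 2.5)
    have hcomp : wordAct δ (xw n) (pb b) =
        ((((Mb b).next (xw n)).enum.symm ((Mb b).T (xw n)
          ((Mb b).enum ⟨⟨pb b, hpb_mem b hbK⟩, hMb_mem b ⟨hbK, htop, hmid⟩⟩)) :
            ↥(reach δ (p₁ b))) : σ) := by
      rw [← MinImage.wordAct_eq, coe_wordAct_restrictδ]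
    -- (c) synchronisation of the suffix
    have hsync : (Mb b).next (xw n) = (Mb b).next (w₀ (p₁ b) ++ msbBlock k l2 (n % K2)) :=
      MinImage.next_msbBlock_eq_of_sync hk1 (Mb b) (hw₀c (p₁ b)) hwinf rfl (by omega)
    -- (d) the output through the root: `T(Mb, xw n) = T(Mr, (n)_k) (cst b)⁻¹`
    have hT : (Mb b).T (xw n) = TT b n := by
      simp only [hTT, hcst]
      rw [eq_mul_inv_iff_mul_eq, ← MinImage.T_msbBlock_eq hzs.1 hzs.2.1 k ν n, hsplit1,
        MinImage.T_append_mul]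
    rw [hread, hcomp, MinImage.coe_enum_symm_congr hsync, hT]
    simp only [hΨ, dif_pos (show Good b from ⟨hbK, htop, hmid⟩)]
  -- the structured model
  set GT := (range K1).filter fun b => GoodTop b ∧ GoodMid b with hGT
  set GB := (range K2).filter fun r => r ∉ syncBad k l2 W with hGB
  have hGT_good : ∀ b, b ∈ GT ↔ Good b := fun b => by
    simp only [hGT, hGood_def, mem_filter, mem_range]
  set c : ℕ → ℂ := fun n => ∑ b ∈ GT, ∑ r ∈ GB, ∑ π : Equiv.Perm (Fin (minRank (δC (p₁ b)))),
    Ψ b r π * ((if n / D = b then (1 : ℂ) else 0) * (if n % K2 = r then 1 else 0) *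
      (if TT b n = π then 1 else 0)) with hc
  have hc_eval : ∀ n, c n =
      if n / D ∈ GT ∧ n % K2 ∈ GB then Ψ (n / D) (n % K2) (TT (n / D) n) else 0 :=
    fun n => sum_sum_sum_mul_ite GT GB Ψ (fun b => TT b n) (n / D) (n % K2)
  -- (1) pointwise comparison for `n ≤ N`
  have hptwise : ∀ n, n < N + 1 → ‖a n - c n‖ ≤
      (if (n / D) / K1s ∈ enterBad k δ q₀ F l1' then B else 0) +
        (if (n / D) % K1s ∈ syncBad k l1s W then B else 0) +
        (if n % K2 ∈ syncBad k l2 W then B else 0) := by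
    intro n hn
    have hnν : n < k ^ ν := lt_of_le_of_lt (Nat.le_of_lt_succ hn) hNν
    have hnD : n / D < K1 := by
      rw [Nat.div_lt_iff_lt_mul hDpos, hK1D]; exact hnν
    have h3nn : ∀ (Q : Prop) [Decidable Q], (0 : ℝ) ≤ (if Q then B else 0) := by
      intro Q _; split_ifs <;> linarith
    by_cases hgood : Good (n / D) ∧ n % K2 ∉ syncBad k l2 W
    · obtain ⟨hg, h2⟩ := hgood
      have hcn : c n = Ψ (n / D) (n % K2) (TT (n / D) n) := by
        rw [hc_eval, if_pos]
        exact ⟨(hGT_good _).2 hg, mem_filter.2 ⟨mem_range.2 (Nat.mod_lt _ hK2pos), h2⟩⟩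
      rw [hcn, ← key n hnν hg h2, sub_self, norm_zero]
      have := h3nn ((n / D) / K1s ∈ enterBad k δ q₀ F l1')
      have := h3nn ((n / D) % K1s ∈ syncBad k l1s W)
      have := h3nn (n % K2 ∈ syncBad k l2 W)
      linarith
    · -- one of the three bad events happens, and `c n = 0`
      have hcn : c n = 0 := by
        rw [hc_eval, if_neg]
        rintro ⟨hT, hB'⟩
        exact hgood ⟨(hGT_good _).1 hT, (mem_filter.1 hB').2⟩
      rw [hcn, sub_zero]
      have hcase : (n / D) / K1s ∈ enterBad k δ q₀ F l1' ∨ (n / D) % K1s ∈ syncBad k l1s W ∨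
          n % K2 ∈ syncBad k l2 W := by
        by_contra hnot
        push Not at hnot
        exact hgood ⟨⟨hnD, hnot.1, hnot.2.1⟩, hnot.2.2⟩
      rcases hcase with h1 | h2 | h3
      · rw [if_pos h1]
        have := h3nn ((n / D) % K1s ∈ syncBad k l1s W)
        have := h3nn (n % K2 ∈ syncBad k l2 W)
        linarith [ha n]
      · rw [if_pos h2]
        have := h3nn ((n / D) / K1s ∈ enterBad k δ q₀ F l1')
        have := h3nn (n % K2 ∈ syncBad k l2 W)
        linarith [ha n]
      · rw [if_pos h3]
        have := h3nn ((n / D) / K1s ∈ enterBad k δ q₀ F l1')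
        have := h3nn ((n / D) % K1s ∈ syncBad k l1s W)
        linarith [ha n]
  -- (2) the `L¹` error
  have hL1 : ∑ n ∈ range (N + 1), ‖a n - c n‖ ≤ ε / 2 * N := by
    have hcnt1 : (((range (N + 1)).filter fun n => (n / D) / K1s ∈ enterBad k δ q₀ F l1').card : ℝ)
        ≤ (enterBad k δ q₀ F l1').card * K1s * D := by
      have h1 := card_filter_div_le hDpos hNK1D (fun b => b / K1s ∈ enterBad k δ q₀ F l1')
      have h2 : ((range K1).filter fun b => b / K1s ∈ enterBad k δ q₀ F l1').card ≤
          (enterBad k δ q₀ F l1').card * K1s := by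
        have := card_filter_div_mem_le K1s hK1spos (enterBad k δ q₀ F l1') (K1 - 1)
        rwa [Nat.sub_add_cancel hK1pos] at this
      exact_mod_cast h1.trans (Nat.mul_le_mul_right _ h2)
    have hcnt2 : (((range (N + 1)).filter fun n => (n / D) % K1s ∈ syncBad k l1s W).card : ℝ)
        ≤ K1' * (syncBad k l1s W).card * D := by
      have h1 := card_filter_div_le hDpos hNK1D (fun b => b % K1s ∈ syncBad k l1s W)
      have h2 : ((range K1).filter fun b => b % K1s ∈ syncBad k l1s W).card ≤
          K1' * (syncBad k l1s W).card := by
        have := card_filter_mod_mem_le K1s (syncBad k l1s W) (K1 - 1)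
        rw [Nat.sub_add_cancel hK1pos] at this
        refine this.trans (Nat.mul_le_mul_right _ ?_)
        have : (K1 - 1) / K1s + 1 ≤ K1' := by
          have hlt : (K1 - 1) / K1s < K1' := by
            rw [Nat.div_lt_iff_lt_mul hK1spos, ← hK1eq]; omega
          omega
        exact this
      exact_mod_cast h1.trans (Nat.mul_le_mul_right _ h2)
    have hcnt3 : (((range (N + 1)).filter fun n => n % K2 ∈ syncBad k l2 W).card : ℝ)
        ≤ (N / K2 + 1 : ℕ) * (syncBad k l2 W).card := by
      exact_mod_cast card_filter_mod_mem_le K2 _ N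
    calc ∑ n ∈ range (N + 1), ‖a n - c n‖
        ≤ ∑ n ∈ range (N + 1), ((if (n / D) / K1s ∈ enterBad k δ q₀ F l1' then B else 0) +
            (if (n / D) % K1s ∈ syncBad k l1s W then B else 0) +
            (if n % K2 ∈ syncBad k l2 W then B else 0)) :=
          sum_le_sum fun n hn => hptwise n (mem_range.1 hn)
      _ = B * ((range (N + 1)).filter fun n => (n / D) / K1s ∈ enterBad k δ q₀ F l1').card +
            B * ((range (N + 1)).filter fun n => (n / D) % K1s ∈ syncBad k l1s W).card +
            B * ((range (N + 1)).filter fun n => n % K2 ∈ syncBad k l2 W).card := by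
          rw [sum_add_distrib, sum_add_distrib, ← sum_filter, ← sum_filter, ← sum_filter,
            sum_const, sum_const, sum_const, nsmul_eq_mul, nsmul_eq_mul, nsmul_eq_mul,
            mul_comm _ B, mul_comm _ B, mul_comm _ B]
      _ ≤ B * ((enterBad k δ q₀ F l1').card * K1s * D) + B * (K1' * (syncBad k l1s W).card * D) +
            B * ((N / K2 + 1 : ℕ) * (syncBad k l2 W).card) := by
          gcongr
      _ ≤ B * (ε / (16 * B * k) * K1' * K1s * D) + B * (K1' * (ε / (16 * B * k) * K1s) * D) +
            B * ((N / K2 + 1 : ℕ) * (ε / (16 * B) * K2)) := by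
          have hl1'' : ((enterBad k δ q₀ F l1').card : ℝ) ≤ ε / (16 * B * k) * (K1' : ℝ) := by
            rw [hK1']; push_cast; exact hl1'
          have hl1s' : ((syncBad k l1s W).card : ℝ) ≤ ε / (16 * B * k) * (K1s : ℝ) := by
            rw [hK1s]; push_cast; exact hl1s
          have hl2' : ((syncBad k l2 W).card : ℝ) ≤ ε / (16 * B) * (K2 : ℝ) := by
            rw [hK2]; push_cast; exact hl2
          gcongr
      _ ≤ ε / 2 * N := by
          have hK1R' : (K1 : ℝ) = K1' * K1s := by rw [hK1eq]; push_cast; ring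
          have h1 : B * (ε / (16 * B * k) * K1' * K1s * D) ≤ ε / 16 * N := by
            have : B * (ε / (16 * B * k) * K1' * K1s * D) = ε / 16 * ((K1 : ℝ) * D / k) := by
              rw [hK1R']; field_simp
            rw [this]
            gcongr
            rw [div_le_iff₀ hkR, mul_comm (N : ℝ)]
            exact hK1DR
          have h2 : B * (K1' * (ε / (16 * B * k) * K1s) * D) ≤ ε / 16 * N := by
            have : B * (K1' * (ε / (16 * B * k) * K1s) * D) = ε / 16 * ((K1 : ℝ) * D / k) := by
              rw [hK1R']; field_simp
            rw [this]
            gcongr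
            rw [div_le_iff₀ hkR, mul_comm (N : ℝ)]
            exact hK1DR
          have h3 : B * (((N / K2 + 1 : ℕ) : ℝ) * (ε / (16 * B) * K2)) ≤ ε / 8 * N := by
            have hq : ((N / K2 + 1 : ℕ) : ℝ) * K2 ≤ 2 * N := by
              have h' : (N / K2 + 1) * K2 ≤ 2 * N := by
                calc (N / K2 + 1) * K2 = N / K2 * K2 + K2 := by ring
                  _ ≤ N + N := add_le_add (Nat.div_mul_le_self N K2) hK2N
                  _ = 2 * N := by ring
              exact_mod_cast h'
            calc B * (((N / K2 + 1 : ℕ) : ℝ) * (ε / (16 * B) * K2))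
                = ε / 16 * ((((N / K2 + 1 : ℕ) : ℝ)) * K2) := by field_simp
              _ ≤ ε / 16 * (2 * N) := by gcongr
              _ = ε / 8 * N := by ring
          have hεN : 0 ≤ ε * N := by positivity
          linarith
  -- (3) the structured part: the root estimates on intervals
  have hMc : ‖moebiusSum c N‖ ≤ ε / 4 * N := by
    have hexp : moebiusSum c N = ∑ b ∈ GT, ∑ r ∈ GB,
        ∑ π : Equiv.Perm (Fin (minRank (δC (p₁ b)))), Ψ b r π *
          ∑ n ∈ (range (N + 1)).filter (fun n => n / D = b ∧ n % K2 = r ∧ TT b n = π),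
            (μ n : ℂ) := by
      rw [hc, moebiusSum_finset_sum]
      refine sum_congr rfl fun b _ => ?_
      rw [moebiusSum_finset_sum]
      refine sum_congr rfl fun r _ => ?_
      rw [moebiusSum_finset_sum]
      refine sum_congr rfl fun π _ => ?_
      rw [moebiusSum_const_mul, moebiusSum, sum_filter]
      congr 1
      refine sum_congr rfl fun n _ => ?_
      by_cases h1 : n / D = b <;> by_cases h2 : n % K2 = r <;> by_cases h3 : TT b n = π <;>
        simp [h1, h2, h3]
    -- each inner sum is a difference of two initial segments controlled by the root estimate
    have hinner : ∀ b ∈ GT, ∀ (r : ℕ) (π : Equiv.Perm (Fin (minRank (δC (p₁ b))))),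
        ‖∑ n ∈ (range (N + 1)).filter (fun n => n / D = b ∧ n % K2 = r ∧ TT b n = π),
          (μ n : ℂ)‖ ≤ 2 * (ε₃ * N) := by
      intro b hb r π
      have hg : Good b := (hGT_good b).1 hb
      have hfin := hfin_of_good b hg.1 hg.2.1
      -- rewrite the condition `TT b n = π` as a root condition
      set Q : ℕ → Prop := fun n => n % K2 = r ∧
        (Mr (p₁ b)).T ((Nat.digits k n).reverse) = π * cst b with hQ
      have hcongr : ((range (N + 1)).filter fun n => n / D = b ∧ n % K2 = r ∧ TT b n = π) =
          ((range (N + 1)).filter fun n => n / D = b).filter Q := by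
        rw [filter_filter]
        refine filter_congr fun n _ => ?_
        simp only [hQ, hTT, mul_inv_eq_iff_eq_mul]
      set g : ℕ → ℂ := fun n => if Q n then (μ n : ℂ) else 0 with hg_def
      have hseg : ∀ y : ℕ, y ≤ N + 1 → ‖∑ n ∈ range y, g n‖ ≤ ε₃ * N := by
        intro y hy
        rw [hg_def, ← sum_filter]
        exact hNp (p₁ b) hfin N (hN3 _) (π * cst b) r y hy
      rw [hcongr, sum_filter, sum_filter_div_eq_eq_sum_Ico hDpos b N g]
      rcases le_or_gt (b * D) (min ((b + 1) * D) (N + 1)) with hle | hgt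
      · rw [sum_Ico_eq_sub _ hle]
        calc ‖∑ n ∈ range (min ((b + 1) * D) (N + 1)), g n - ∑ n ∈ range (b * D), g n‖
            ≤ ‖∑ n ∈ range (min ((b + 1) * D) (N + 1)), g n‖ + ‖∑ n ∈ range (b * D), g n‖ :=
              norm_sub_le _ _
          _ ≤ ε₃ * N + ε₃ * N :=
              add_le_add (hseg _ (min_le_right _ _)) (hseg _ (hle.trans (min_le_right _ _)))
          _ = 2 * (ε₃ * N) := by ring
      · rw [Ico_eq_empty_of_le hgt.le, sum_empty, norm_zero]
        positivity
    rw [hexp]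
    calc ‖∑ b ∈ GT, ∑ r ∈ GB, ∑ π : Equiv.Perm (Fin (minRank (δC (p₁ b)))), Ψ b r π *
          ∑ n ∈ (range (N + 1)).filter (fun n => n / D = b ∧ n % K2 = r ∧ TT b n = π),
            (μ n : ℂ)‖
        ≤ ∑ b ∈ GT, ∑ r ∈ GB, ∑ _π : Equiv.Perm (Fin (minRank (δC (p₁ b)))),
            B * (2 * (ε₃ * N)) := by
          refine (norm_sum_le _ _).trans (sum_le_sum fun b hb => ?_)
          refine (norm_sum_le _ _).trans (sum_le_sum fun r _ => ?_)
          refine (norm_sum_le _ _).trans (sum_le_sum fun π _ => ?_)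
          rw [norm_mul]
          exact mul_le_mul (hΨB b r π) (hinner b hb r π) (norm_nonneg _) hB0.le
      _ = ∑ b ∈ GT, (GB.card : ℝ) *
            ((Fintype.card (Equiv.Perm (Fin (minRank (δC (p₁ b))))) : ℝ) * (B * (2 * (ε₃ * N)))) := by
          refine sum_congr rfl fun b _ => ?_
          rw [sum_const, nsmul_eq_mul, sum_const, card_univ, nsmul_eq_mul]
      _ ≤ ∑ _b ∈ GT, (K2 : ℝ) * (P * (B * (2 * (ε₃ * N)))) := by
          refine sum_le_sum fun b _ => ?_
          have hGB : (GB.card : ℝ) ≤ K2 := by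
            exact_mod_cast (card_filter_le _ _).trans_eq (card_range K2)
          have hε₃N : 0 ≤ B * (2 * (ε₃ * N)) := by positivity
          gcongr
          exact hPerm (p₁ b)
      _ = (GT.card : ℝ) * ((K2 : ℝ) * (P * (B * (2 * (ε₃ * N))))) := by rw [sum_const, nsmul_eq_mul]
      _ ≤ (K1 : ℝ) * ((K2 : ℝ) * (P * (B * (2 * (ε₃ * N))))) := by
          have hGTc : (GT.card : ℝ) ≤ K1 := by
            exact_mod_cast (card_filter_le _ _).trans_eq (card_range K1)
          have : 0 ≤ (K2 : ℝ) * (P * (B * (2 * (ε₃ * N)))) := by positivity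
          gcongr
      _ = ε / 8 * N := by
          rw [hε₃]
          exact rootReduction_const_identity ε B K1 K2 P N hB0 hK1R hK2R (by exact_mod_cast hP1)
      _ ≤ ε / 4 * N := by
          have hεN : 0 ≤ ε * N := by positivity
          linarith
  -- conclusion
  calc ‖moebiusSum a N‖ = ‖(moebiusSum a N - moebiusSum c N) + moebiusSum c N‖ := by
        rw [sub_add_cancel]
    _ ≤ ‖moebiusSum a N - moebiusSum c N‖ + ‖moebiusSum c N‖ := norm_add_le _ _
    _ ≤ ε / 2 * N + ε / 4 * N := add_le_add ((norm_moebiusSum_sub_le a c N).trans hL1) hMc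
    _ ≤ ε * N := by
        have hεN : 0 ≤ ε * N := by positivity
        linarith

end Main

/-! ## Assembly through the base change -/

section Assembly

/-- The hypothesis of the reduction, for a base-`k` automaton `Δ` on `σ` (to be read: after
digit restriction): every final component has a zero-stable root with `RootAPEstimate`.
An abbreviation for readability of the assembly; NOT asserted. [cite: Mullner2017, Prop. 3.2] -/
def FinalComponentsRootAPEstimate {σ : Type} [Fintype σ] [DecidableEq σ] (k : ℕ)
    (Δ : σ → ℕ → σ) : Prop :=
  ∀ p ∈ finalStates Δ, ∃ Mr : MinImage (restrictδ Δ (reach Δ p) (reach_closed Δ p)),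
    Mr.next [0] = Mr ∧ Mr.T [0] = 1 ∧
      RootAPEstimate k (restrictδ Δ (reach Δ p) (reach_closed Δ p)) Mr

/-- **Müllner's theorem from root estimates in a power base** (Prop. 3.3 + Prop. 2.25 +
Cor. 2.26): if for every `k ≥ 2` and every finite base-`k` DFAO with `δ(q₀, 0) = q₀` there is
`p ≥ 1` such that the digit-restricted `p`-th power automaton (base `k^p`, letter `D < k^p` acting
as the block `(D)_k^p`, `powδ`) satisfies `FinalComponentsRootAPEstimate (k^p)`, then
`mullner_moebius_automatic` holds. Chain: finite `k`-kernel ⇒ MSB-first DFAO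
(`isAutomaticSeq_iff_exists_dfaoSeq`) ⇒ normalisation `δ(q₀,0) = q₀` (`dfaoSeq_optionLift`) ⇒
same sequence in base `k^p` (`dfaoSeq_pow`, `powδ_zero`) ⇒ digit restriction
(`dfaoSeq_digitRestrict`) ⇒ `isLittleO_moebiusSum_dfaoSeq_of_rootAPEstimate`.
[cite: Mullner2017, Prop. 3.3, Prop. 2.25, Cor. 2.26] -/
theorem mullner_moebius_automatic_of_rootAPEstimate_pow
    (H : ∀ (k : ℕ), 2 ≤ k → ∀ (σ : Type) [Fintype σ] [DecidableEq σ] (δ : σ → ℕ → σ) (q₀ : σ),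
      δ q₀ 0 = q₀ → ∃ p : ℕ, 1 ≤ p ∧
        FinalComponentsRootAPEstimate (k ^ p) (digitRestrict (k ^ p) (powδ k p δ))) :
    mullner_moebius_automatic := by
  classical
  rw [mullner_moebius_automatic_iff_isLittleO]
  intro k hk a ha
  obtain ⟨σ, _, δ, q₀, τ, rfl⟩ := ha.exists_dfaoSeq hk
  -- normalise the initial state
  rw [← dfaoSeq_optionLift k δ q₀ τ]
  set δ₁ := optionLiftδ δ q₀
  have h0 : δ₁ none 0 = none := optionLiftδ_none_zero δ q₀
  obtain ⟨p, hp, Hp⟩ := H k hk (Option σ) δ₁ none h0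
  -- pass to base `K = k^p`
  have hK : 2 ≤ k ^ p := by
    calc 2 ≤ k := hk
      _ = k ^ 1 := (pow_one k).symm
      _ ≤ k ^ p := Nat.pow_le_pow_right (by omega) hp
  rw [← dfaoSeq_pow hk hp h0 (optionLiftτ τ q₀),
    ← dfaoSeq_digitRestrict hK (powδ k p δ₁) none (optionLiftτ τ q₀)]
  refine isLittleO_moebiusSum_dfaoSeq_of_rootAPEstimate hK _ none _ ?_
    (digitRestrict_trivial (k ^ p) (powδ k p δ₁)) Hp
  rw [digitRestrict_of_lt _ _ (by positivity : 0 < k ^ p)]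
  exact powδ_zero h0

end Assembly

end Literature.NumberTheory.LFunctions
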